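import Literature.NumberTheory.GaloisRepresentations.TameInertiaProofs
import Literature.NumberTheory.GaloisRepresentations.TameInertiaCyclicProofs
import Literature.NumberTheory.GaloisRepresentations.UnramifiedKummer
import HarnessLib

/-!
# Discharge of `exists_eq_kummerCharacter_pow`: characters of `I_F` of exponent prime to `p`
are powers of the Kummer character `θ_d` (trunk GalRep, item C15)

D-0014 keeps `Literature/` sorry-free by stating cited results as named facts `def X : Prop`.
This third sibling file of `Literature.NumberTheory.GaloisRepresentations.TameInertia` (after
`TameInertiaProofs`, `TameInertiaCyclicProofs`) proves the named fact

* `Literature.exists_eq_kummerCharacter_pow_holds : exists_eq_kummerCharacter_pow F k` — for a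
  non-archimedean local field `F` (any characteristic), a field `k` with the discrete topology
  and a residue embedding `ι : S ⧸ 𝔓 →+* k`, every continuous character `χ : I_F → kˣ` with
  `χ ^ d = 1`, `p ∤ d`, is a power `θ_d ^ a` of the Kummer character
  `θ_d = kummerCharacter F hd hϖ.ne_zero ι` of a uniformiser `ϖ`
  (Serre, Invent. Math. 15 (1972), §1.3: `θ_d : Gal(K_d/K_nr) ≃ μ_d`, `K_t = ⋃ K_d`,
  Prop. 1: `θ : I_t ≃ lim← μ_d`; §1.7, Prop. 5: `a/d ↦ χ_{a/d} = θ_d^a` is an isomorphism of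
  `(ℚ/ℤ)'` onto the group `X = Hom(I_t, k_s^*)` of continuous characters, `X = lim→ Hom(μ_d, k_s^*)`;
  §1.7, "Plus généralement, soit `k₁` un corps de caractéristique `p`": characters with values
  in `k₁^*` through an embedding of `𝔽_q` into `k₁`),

as `theorem X_holds : X` (users holding `(h : X)` are fed `X_holds`; the consumer is
`ModPGaloisRep.InertiaShape.exists_isSerreWeight_of_facts` / `SerreWeightExistence`).

## Proof

Serre's argument is: `χ` is tame (its image has order prime to `p`), hence factors through
`I_t = lim← μ_d`, which is pro-cyclic, and `θ_d` is *the* quotient `I_t ↠ μ_d`.  We run it at a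
finite level, with the following inputs of the tree:

1. (`UnramifiedKummer.exists_mem_absInertia_smul_eq_mul`, Serre 1972 §1.3) **`θ_d` is
   surjective**: for a primitive `d`-th root of unity `ζ₀ ∈ F̄` some `σ₀ ∈ I_F` has
   `σ₀ z = ζ₀ z`, `z = kummerRoot` the chosen root of `z ^ d = ϖ`;
2. (`TameInertiaCyclicProofs.exists_inertiaCharacter`, *Local Fields* IV §2 Prop. 7) at a finite
   Galois level `E/F`, Serre's `θ₀ : G_0 → (O_E ⧸ 𝔓_E)ˣ` with kernel `G_1`;
3. (`TameInertiaProofs.isPGroup_ramificationSubgroup_one_of_isGalois`, IV §2 Cor. 3) `G_1` is a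
   `p`-group;
4. (`InertiaRootsOfUnity.eq_one_of_pow_eq_one_of_sub_one_mem_absMaximalIdeal`, Serre 1972
   §1.3) roots of unity of order prime to `p` are distinct modulo `𝔓`.

*Step 1.*  `N = ker χ ∩ ker θ_d ≤ I_F` contains all `d`-th powers, and all `σ ∈ I_F` restricting
trivially to a suitable finite Galois `E/F`: `ker χ` is open (continuity, `k` discrete) and
`ker θ_d ⊇ Stab(z)`, so `N ⊇ I_F ∩ U` for an open `U ∋ 1` of `Γ_F`, and `U ⊇ Gal(F̄/E)` (Krull
topology; in characteristic `p` one passes to `E ∩ F^{sep}`, `exists_isGalois_mem_of_restrict_eq_one`).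

*Step 2* (`absInertia_exists_eq_mul_zpow`: **tame quotients of `I_F` are cyclic**).  The
restriction of `I_F` to `E` lies in `G_0`; `φ = θ₀ ∘ res : I_F → (O_E ⧸ 𝔓_E)ˣ` has cyclic image
`⟨φ g⟩` (a finite subgroup of the units of a field); for `σ ∈ I_F` with `φ σ = φ g ^ n`, the
element `τ = σ g⁻ⁿ` restricts into `ker θ₀ = G_1`, so `τ^{p^j}` restricts trivially and lies in
`N`, as does `τ^d`; since `gcd(p^j, d) = 1`, `τ ∈ N`.  Hence `I_F = N · ⟨g⟩`.

*Step 3.*  `t = θ_d(g)` generates `θ_d(I_F) ∋ θ_d(σ₀) = ι(ζ₀ mod 𝔓)`, which has order exactly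
`d` by (4) and the injectivity of `ι`; as `t ^ d = 1`, `t` is a primitive `d`-th root of unity of
`k`, so the `d`-th root of unity `χ(g)` is `t ^ a` (`IsPrimitiveRoot.eq_pow_of_pow_eq_one`), and
`χ = θ_d ^ a` on `N · ⟨g⟩ = I_F`.

Only Mathlib and proved results of `Literature/` are used; no hypothesis on the characteristic
of `F`.

## References

* [SerreInventiones1972] J.-P. Serre, *Propriétés galoisiennes des points d'ordre fini des
  courbes elliptiques*, Invent. Math. 15 (1972), 259–331 (= Œuvres III, n° 94): §1.2
  (`I`, `I_p`, `I_t = I/I_p` "groupe profini commutatif, d'ordre premier à `p`"), §1.3 (`θ_d`,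
  Prop. 1–2), §1.7 (Prop. 5; fundamental characters with values in a field `k₁`).
* [SerreLocalFields1979] J.-P. Serre, *Local Fields*, GTM 67, Springer 1979, Ch. IV §2, Prop. 7,
  Cor. 1 (`G_0/G_1` cyclic of order prime to `p`) and Cor. 3 (`G_1` is a `p`-group).
* [NeukirchANT1999] J. Neukirch, *Algebraic Number Theory*, Springer 1999, Ch. IV §1 (Krull
  topology).
-/

noncomputable section

open ValuativeRel Field
open scoped Pointwise Valued IntermediateField

namespace Literature.NumberTheory.GaloisRepresentations

open GaloisRepresentations.IsNonarchimedeanLocalField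

section FiniteLevel

variable (F : Type*) [Field F] [ValuativeRel F] [TopologicalSpace F] [IsNonarchimedeanLocalField F]

omit [ValuativeRel F] [TopologicalSpace F] [IsNonarchimedeanLocalField F] in
/-- **Open neighbourhoods of `1` in `Γ_F` contain the kernel of a finite Galois level.**  If
`U ⊆ Γ_F` is open and contains `1`, there is a finite Galois subextension `E/F` of `F̄` such that
every `σ` restricting trivially to `E` lies in `U` (Krull topology: `U ⊇ Gal(F̄/E')` for a finite
normal `E'`, and `Gal(F̄/E' ∩ F^{sep}) = Gal(F̄/E')`; cf. `exists_isGalois_ker_le`).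
Ref: Neukirch, *Algebraic Number Theory*, Ch. IV §1, (1.2). [folklore] -/
theorem exists_isGalois_mem_of_restrict_eq_one {U : Set (absoluteGaloisGroup F)} (hU : IsOpen U)
    (h1 : (1 : absoluteGaloisGroup F) ∈ U) :
    ∃ E : IntermediateField F (AlgebraicClosure F), ∃ (_ : FiniteDimensional F E) (_ : IsGalois F E),
      ∀ σ : absoluteGaloisGroup F, absRestrictNormalHom (K := F) E σ = 1 → σ ∈ U := by
  have hnhds : U ∈ nhds (1 : absoluteGaloisGroup F) := hU.mem_nhds h1
  obtain ⟨E', hfin, hnorm, hE'⟩ :=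
    (krullTopology_mem_nhds_one_iff_of_normal F (AlgebraicClosure F) _).mp hnhds
  haveI := hfin
  haveI := hnorm
  haveI hfinE : FiniteDimensional F (E' ⊓ separableClosure F (AlgebraicClosure F) :
      IntermediateField F (AlgebraicClosure F)) :=
    FiniteDimensional.of_injective
      (IntermediateField.inclusion (inf_le_left : E' ⊓ separableClosure F (AlgebraicClosure F) ≤ E')).toLinearMap
      (IntermediateField.inclusion_injective
        (inf_le_left : E' ⊓ separableClosure F (AlgebraicClosure F) ≤ E'))
  haveI hsepE : Algebra.IsSeparable F (E' ⊓ separableClosure F (AlgebraicClosure F) :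
      IntermediateField F (AlgebraicClosure F)) :=
    (le_separableClosure_iff F (AlgebraicClosure F) _).mp inf_le_right
  haveI hnormE : Normal F (E' ⊓ separableClosure F (AlgebraicClosure F) :
      IntermediateField F (AlgebraicClosure F)) := inferInstance
  haveI hgalE : IsGalois F (E' ⊓ separableClosure F (AlgebraicClosure F) :
      IntermediateField F (AlgebraicClosure F)) := ⟨⟩
  refine ⟨E' ⊓ separableClosure F (AlgebraicClosure F), hfinE, hgalE, fun σ hσ => ?_⟩
  have hσk : σ ∈ (absRestrictNormalHom (K := F) (E' ⊓ separableClosure F (AlgebraicClosure F))).ker := hσ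
  have hσ' : absoluteGaloisGroup.toAlgEquiv F σ ∈
      (E' ⊓ separableClosure F (AlgebraicClosure F)).fixingSubgroup := by
    rw [← IntermediateField.restrictNormalHom_ker]
    exact hσk
  exact hE' (mem_fixingSubgroup_of_mem_fixingSubgroup_inf_separableClosure F E' _ hσ')

/-- The restriction to a finite normal level `E` of an element of `I_F` lies in the inertia group
of `𝔓_E = 𝔓 ∩ E` (equivariance of `integralClosure 𝒪[F] E → S`).
Ref: Serre, *Local Fields*, Ch. I §7, Prop. 22. [folklore] -/
theorem absRestrictNormalHom_mem_inertia_comap (E : IntermediateField F (AlgebraicClosure F)) [Normal F E]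
    {σ : absoluteGaloisGroup F} (hσ : σ ∈ absInertia F) :
    absRestrictNormalHom E σ ∈
      ((absMaximalIdeal F).comap (E.integralClosureToAbsIntegers 𝒪[F])).inertia (E ≃ₐ[F] E) := by
  refine AddSubgroup.mem_inertia.mpr fun x => ?_
  change E.integralClosureToAbsIntegers 𝒪[F] (absRestrictNormalHom E σ • x - x) ∈ absMaximalIdeal F
  have heq : E.integralClosureToAbsIntegers 𝒪[F] (absRestrictNormalHom E σ • x) =
      σ • E.integralClosureToAbsIntegers 𝒪[F] x :=
    E.integralClosureToAbsIntegers_restrictNormalHom_smul 𝒪[F] σ x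
  rw [map_sub, heq]
  exact hσ _

omit [ValuativeRel F] [TopologicalSpace F] [IsNonarchimedeanLocalField F] in
/-- Group theory: if the image of `φ : G → H` is cyclic, generated by `φ g`, then every `σ ∈ G`
satisfies `φ (σ g⁻ⁿ) = 1` for some `n`.  (Stated for abstract groups so that no instance on the
heavy concrete types below has to be unfolded.) [folklore] -/
theorem _root_.MonoidHom.exists_apply_mul_zpow_inv_eq_one {G H : Type*} [Group G] [Group H]
    (φ : G →* H) [IsCyclic φ.range] : ∃ g : G, ∀ σ : G, ∃ n : ℤ, φ (σ * (g ^ n)⁻¹) = 1 := by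
  obtain ⟨x, hx⟩ := IsCyclic.exists_generator (α := φ.range)
  obtain ⟨g, hg⟩ : ∃ g, φ g = (x : H) := x.2
  refine ⟨g, fun σ => ?_⟩
  obtain ⟨n, hn⟩ := Subgroup.mem_zpowers_iff.mp (hx ⟨φ σ, σ, rfl⟩)
  refine ⟨n, ?_⟩
  have h : φ g ^ n = φ σ := by
    have h' := congrArg Subtype.val hn
    rw [SubgroupClass.coe_zpow, ← hg] at h'
    exact h'
  rw [map_mul, map_inv, map_zpow, h, mul_inv_cancel]

/-- **Tame quotients of `I_F` of exponent prime to `p` are cyclic** (the group-theoretic heart of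
Serre's `Hom(I_t, μ_d) = ⟨θ_d⟩`).  Let `N ≤ I_F` be a subgroup containing all `d`-th powers
(`p ∤ d`) and all elements restricting trivially to a finite Galois level `E`.  Then `I_F = N · ⟨g⟩`
for some `g ∈ I_F`: every `σ ∈ I_F` is `ν g^n` with `ν ∈ N`.  Proof: the restriction of `I_F` to
`E` lies in the inertia group `G_0` of `𝔓_E`; composing with Serre's `θ₀ : G_0 → (O_E ⧸ 𝔓_E)ˣ`
(kernel `G_1`, `exists_inertiaCharacter`) gives `φ : I_F → (O_E ⧸ 𝔓_E)ˣ` with cyclic image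
`⟨φ g⟩`; for `σ ∈ I_F` with `φ σ = φ g ^ n`, `τ = σ g^{-n}` restricts into `G_1`, a `p`-group
(`isPGroup_ramificationSubgroup_one_of_isGalois`), so `τ^{p^j} ∈ N`; with `τ^d ∈ N` and
`gcd(p^j, d) = 1`, `τ ∈ N`.
Ref: Serre, *Local Fields*, Ch. IV §2, Cor. 1 of Prop. 7 (`G_0/G_1` cyclic of order prime to
`p`) and Cor. 3 (`G_1` is a `p`-group); Serre, Invent. Math. 15 (1972), §1.3, Prop. 2
(`I_t = lim← μ_d` pro-cyclic). [cite: SerreLocalFields1979, Ch. IV §2 Cor. 1 and Cor. 3 of Prop. 7] -/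
theorem absInertia_exists_eq_mul_zpow {d : ℕ} (hpd : ¬ ringChar 𝓀[F] ∣ d)
    (N : Subgroup ↥(absInertia F)) (hNd : ∀ τ : ↥(absInertia F), τ ^ d ∈ N)
    (E : IntermediateField F (AlgebraicClosure F)) [FiniteDimensional F E] [IsGalois F E]
    (hNE : ∀ τ : ↥(absInertia F), absRestrictNormalHom E (τ : absoluteGaloisGroup F) = 1 → τ ∈ N) :
    ∃ g : ↥(absInertia F), ∀ σ : ↥(absInertia F), ∃ n : ℤ, ∃ ν ∈ N, σ = ν * g ^ n := by
  classical
  -- the prime `Q = 𝔓_E` and the inertia group `G_0`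
  haveI hQ : ((absMaximalIdeal F).comap (E.integralClosureToAbsIntegers 𝒪[F])).IsMaximal :=
    isMaximal_comap_integralClosureToAbsIntegers 𝒪[F] (absMaximalIdeal F) E
  haveI : Finite (integralClosure 𝒪[F] E ⧸ (absMaximalIdeal F).comap (E.integralClosureToAbsIntegers 𝒪[F])) :=
    finite_integralClosure_quotient F E
  -- restriction `ψ : I_F → G_0` (kept opaque: only its defining property is used)
  obtain ⟨ψ, hψ⟩ : ∃ ψ : ↥(absInertia F) →*
      ↥(((absMaximalIdeal F).comap (E.integralClosureToAbsIntegers 𝒪[F])).inertia (E ≃ₐ[F] E)),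
      ∀ τ : ↥(absInertia F), ((ψ τ : _) : E ≃ₐ[F] E) = absRestrictNormalHom E (τ : absoluteGaloisGroup F) :=
    ⟨((absRestrictNormalHom E).comp (absInertia F).subtype).codRestrict _
      (fun τ => absRestrictNormalHom_mem_inertia_comap F E τ.2), fun _ => rfl⟩
  -- Serre's `θ₀` and the composite `φ = θ₀ ∘ ψ`
  obtain ⟨θ₀, hθ₀⟩ := exists_inertiaCharacter F E
  obtain ⟨φ, hφ⟩ : ∃ φ : ↥(absInertia F) →* (integralClosure 𝒪[F] E ⧸
      (absMaximalIdeal F).comap (E.integralClosureToAbsIntegers 𝒪[F]))ˣ, ∀ τ, φ τ = θ₀ (ψ τ) :=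
    ⟨θ₀.comp ψ, fun _ => rfl⟩
  -- the image of `φ` is a finite subgroup of the units of a field, hence cyclic
  haveI : Finite ((integralClosure 𝒪[F] E ⧸
      (absMaximalIdeal F).comap (E.integralClosureToAbsIntegers 𝒪[F]))ˣ) := inferInstance
  haveI : Finite φ.range := inferInstance
  haveI : IsCyclic φ.range := isCyclic_subgroup_units _
  obtain ⟨g, hg⟩ := φ.exists_apply_mul_zpow_inv_eq_one
  refine ⟨g, fun σ => ?_⟩
  obtain ⟨n, hφτ⟩ := hg σ
  -- it suffices that `τ = σ g^{-n}` lies in `N`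
  suffices hτN : σ * (g ^ n)⁻¹ ∈ N by exact ⟨n, _, hτN, by rw [inv_mul_cancel_right]⟩
  generalize σ * (g ^ n)⁻¹ = τ at hφτ ⊢
  -- `φ τ = 1`, so `τ` restricts into `G_1`
  have hG1 : ((ψ τ : _) : E ≃ₐ[F] E) ∈
      ((absMaximalIdeal F).comap (E.integralClosureToAbsIntegers 𝒪[F])).ramificationSubgroup (E ≃ₐ[F] E) 1 :=
    (hθ₀ (ψ τ)).mp (by rw [← hφ]; exact hφτ)
  -- `G_1` is a `p`-group: `τ ^ (p ^ j)` restricts trivially, hence lies in `N`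
  obtain ⟨j, hj⟩ := isPGroup_ramificationSubgroup_one_of_isGalois F E ⟨_, hG1⟩
  have hj' : absRestrictNormalHom E ((τ ^ (ringChar 𝓀[F] ^ j) : ↥(absInertia F)) : absoluteGaloisGroup F) = 1 := by
    have h1 := congrArg Subtype.val hj
    rw [Subgroup.coe_pow, Subgroup.coe_one] at h1
    rw [Subgroup.coe_pow, map_pow, ← hψ]
    exact h1
  have hτp : τ ^ (ringChar 𝓀[F] ^ j) ∈ N := hNE _ hj'
  have hτd : τ ^ d ∈ N := hNd τ
  -- `gcd(p^j, d) = 1`, so `τ ∈ N`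
  have hp : (ringChar 𝓀[F]).Prime := ringChar_residueField_prime (F := F)
  have hcop : Nat.Coprime (ringChar 𝓀[F] ^ j) d :=
    Nat.Coprime.pow_left j ((Nat.Prime.coprime_iff_not_dvd hp).mpr hpd)
  obtain ⟨a, b, hab⟩ := Nat.isCoprime_iff_coprime.mpr hcop
  have heq : τ = (τ ^ (ringChar 𝓀[F] ^ j)) ^ a * (τ ^ d) ^ b := by
    rw [← zpow_natCast τ (ringChar 𝓀[F] ^ j), ← zpow_natCast τ d, ← zpow_mul, ← zpow_mul,
      ← zpow_add, mul_comm _ a, mul_comm _ b, hab, zpow_one]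
  rw [heq]
  exact N.mul_mem (N.zpow_mem hτp a) (N.zpow_mem hτd b)

end FiniteLevel

/-! ### The discharge -/

section Main

variable (F : Type*) [Field F] [ValuativeRel F] [TopologicalSpace F] [IsNonarchimedeanLocalField F]
variable (k : Type*) [Field k] [TopologicalSpace k]

/-- A natural number prime to `p = char 𝓀[F]` is a unit of `𝒪[F]`. [folklore] -/
theorem isUnit_natCast_of_not_ringChar_dvd {d : ℕ} (hpd : ¬ ringChar 𝓀[F] ∣ d) :
    IsUnit ((d : ℕ) : 𝒪[F]) := by
  by_contra h
  have hmem : ((d : ℕ) : 𝒪[F]) ∈ 𝓂[F] := (IsLocalRing.mem_maximalIdeal _).mpr h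
  have h0 : IsLocalRing.residue 𝒪[F] ((d : ℕ) : 𝒪[F]) = 0 :=
    (IsLocalRing.residue_eq_zero_iff _).mpr hmem
  rw [map_natCast] at h0
  exact hpd ((ringChar.spec 𝓀[F] d).mp h0)

/-- **`exists_eq_kummerCharacter_pow` from the surjectivity of `θ_d`** (hypothesis `hsurj`: for a
primitive `d`-th root of unity `ζ` some `σ ∈ I_F` has `σ z = ζ z`, `z` the chosen root of
`z ^ d = ϖ`; proved in `UnramifiedKummer.exists_mem_absInertia_smul_eq_mul`).
Proof (Serre 1972, §1.3 and §1.7 Prop. 5, `Hom(I_t, μ_d) = (1/d)ℤ/ℤ · θ_d`): with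
`N = ker χ ∩ ker θ_d`, which contains the `d`-th powers and the elements of `I_F` restricting
trivially to a suitable finite Galois level (continuity of `χ`; `ker θ_d ⊇ Stab(z)`), the tame
quotient `I_F / N` is cyclic, `I_F = N ⟨g⟩` (`absInertia_exists_eq_mul_zpow`); `t = θ_d(g)`
generates `θ_d(I_F) ∋ ι(ζ mod 𝔓)`, an element of order `d` (roots of unity of order prime to
`p` are distinct mod `𝔓`, `ι` is injective), so `t` is a primitive `d`-th root of unity of `k`
and `χ(g)`, a `d`-th root of unity, is `t ^ a`; hence `χ = θ_d ^ a` on `N ⟨g⟩ = I_F`.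
[cite: SerreInventiones1972, §1.3 and §1.7 Prop. 5] -/
theorem exists_eq_kummerCharacter_pow_of_surjective
    (hsurj : ∀ {d : ℕ} (hd : 0 < d) {ϖ : 𝒪[F]} (_hϖ : Irreducible ϖ) {ζ : AlgebraicClosure F}
      (_hζ : ζ ^ d = 1), ∃ σ ∈ absInertia F,
        σ • (kummerRoot F hd ϖ : AlgebraicClosure F) = ζ * kummerRoot F hd ϖ) :
    exists_eq_kummerCharacter_pow F k := by
  intro _ ι d hd hpd ϖ hϖ χ hχ hχd
  classical
  letI : Field (absIntegers 𝒪[F] F ⧸ absMaximalIdeal F) := Ideal.Quotient.field _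
  have hι : Function.Injective ι := ι.injective
  set θ := kummerCharacter F hd hϖ.ne_zero ι with hθdef
  set z : AlgebraicClosure F := (kummerRoot F hd ϖ : AlgebraicClosure F) with hzdef
  have hz : z ^ d = algebraMap 𝒪[F] (AlgebraicClosure F) ϖ := coe_kummerRoot_pow F hd ϖ
  have hz0 : z ≠ 0 := coe_kummerRoot_ne_zero hd hϖ.ne_zero
  have hdu : IsUnit ((d : ℕ) : 𝒪[F]) := isUnit_natCast_of_not_ringChar_dvd F hpd
  -- values of `θ`
  have hθval : ∀ σ : ↥(absInertia F),
      (θ σ : k) = ι (Ideal.Quotient.mk _ (kummerCocycleInt F hd hϖ.ne_zero σ)) := fun σ =>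
    coe_kummerCharacter_apply F hd hϖ.ne_zero ι σ
  have hcoc : ∀ σ : absoluteGaloisGroup F,
      (kummerCocycleInt F hd hϖ.ne_zero σ : AlgebraicClosure F) = σ • z / z := fun σ => rfl
  -- (T1) `θ ^ d = 1`
  have hθd : ∀ σ : ↥(absInertia F), θ σ ^ d = 1 := fun σ => by
    ext
    rw [Units.val_pow_eq_pow_val, hθval, ← map_pow, ← map_pow, kummerCocycleInt_pow hd hϖ.ne_zero,
      map_one, map_one, Units.val_one]
  -- (T0) `σ z = z → θ σ = 1`
  have hθfix : ∀ σ : ↥(absInertia F), (σ : absoluteGaloisGroup F) • z = z → θ σ = 1 := fun σ hσ => by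
    ext
    rw [hθval, Units.val_one]
    have : kummerCocycleInt F hd hϖ.ne_zero σ = 1 := Subtype.ext (by
      rw [hcoc, hσ, div_self hz0, OneMemClass.coe_one])
    rw [this, map_one, map_one]
  -- Step 1: the open neighbourhood `U` of `1` and the finite Galois level `E`
  have hzi : IsIntegral F z :=
    IsIntegral.of_pow hd (by rw [hz, IsScalarTower.algebraMap_apply 𝒪[F] F (AlgebraicClosure F)]; exact isIntegral_algebraMap)
  haveI : FiniteDimensional F F⟮z⟯ := IntermediateField.adjoin.finiteDimensional hzi
  have hkerOpen : IsOpen {σ : ↥(absInertia F) | χ σ = 1} :=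
    (isOpen_discrete ({1} : Set kˣ)).preimage hχ
  obtain ⟨V, hV, hVeq⟩ := isOpen_induced_iff.mp hkerOpen
  set U : Set (absoluteGaloisGroup F) :=
    V ∩ {σ | absoluteGaloisGroup.toAlgEquiv F σ ∈ F⟮z⟯.fixingSubgroup} with hUdef
  have hUopen : IsOpen U := hV.inter (IntermediateField.fixingSubgroup_isOpen F⟮z⟯)
  have h1U : (1 : absoluteGaloisGroup F) ∈ U := by
    refine ⟨?_, ?_⟩
    · have : (1 : ↥(absInertia F)) ∈ Subtype.val ⁻¹' V := by
        rw [hVeq]; exact map_one χ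
      exact this
    · rw [Set.mem_setOf_eq, map_one]; exact Subgroup.one_mem _
  obtain ⟨E, hfin, hgal, hE⟩ := exists_isGalois_mem_of_restrict_eq_one F hUopen h1U
  -- the subgroup `N = ker χ ⊓ ker θ`
  set N : Subgroup ↥(absInertia F) := χ.ker ⊓ θ.ker with hNdef
  have hNd : ∀ τ : ↥(absInertia F), τ ^ d ∈ N := fun τ =>
    Subgroup.mem_inf.mpr ⟨MonoidHom.mem_ker.mpr (by rw [map_pow, hχd]),
      MonoidHom.mem_ker.mpr (by rw [map_pow, hθd])⟩
  have hNE : ∀ τ : ↥(absInertia F), absRestrictNormalHom E (τ : absoluteGaloisGroup F) = 1 → τ ∈ N := by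
    intro τ hτ
    obtain ⟨hτV, hτz⟩ := hE _ hτ
    refine Subgroup.mem_inf.mpr ⟨?_, MonoidHom.mem_ker.mpr ?_⟩
    · have : τ ∈ Subtype.val ⁻¹' V := hτV
      rw [hVeq] at this
      exact MonoidHom.mem_ker.mpr this
    · refine hθfix τ ?_
      rw [absoluteGaloisGroup.smul_def]
      exact (IntermediateField.mem_fixingSubgroup_iff _ _).mp hτz z (IntermediateField.mem_adjoin_simple_self F z)
  -- Step 2: `I_F = N ⟨g⟩`
  obtain ⟨g, hg⟩ := absInertia_exists_eq_mul_zpow F hpd N hNd E hNE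
  have hχeval : ∀ (ν : ↥(absInertia F)) (_ : ν ∈ N) (n : ℤ), χ (ν * g ^ n) = χ g ^ n := fun ν hν n => by
    rw [map_mul, map_zpow, show χ ν = 1 from MonoidHom.mem_ker.mp (Subgroup.mem_inf.mp hν).1, one_mul]
  have hθeval : ∀ (ν : ↥(absInertia F)) (_ : ν ∈ N) (n : ℤ), θ (ν * g ^ n) = θ g ^ n := fun ν hν n => by
    rw [map_mul, map_zpow, show θ ν = 1 from MonoidHom.mem_ker.mp (Subgroup.mem_inf.mp hν).2, one_mul]
  set t : kˣ := θ g with htdef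
  -- Step 3a: a primitive `d`-th root of unity `ζ₀ ∈ F̄` and `σ₀ ∈ I_F` with `σ₀ z = ζ₀ z`
  haveI : NeZero ((d : ℕ) : AlgebraicClosure F) := ⟨by
    have hu := hdu.map (algebraMap 𝒪[F] (AlgebraicClosure F))
    rw [map_natCast] at hu
    exact hu.ne_zero⟩
  haveI : NeZero d := ⟨hd.ne'⟩
  obtain ⟨ζ₀, hζ₀⟩ := HasEnoughRootsOfUnity.exists_primitiveRoot (AlgebraicClosure F) d
  obtain ⟨σ₀, hσ₀I, hσ₀⟩ := hsurj hd hϖ hζ₀.pow_eq_one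
  have hζ₀i : IsIntegral 𝒪[F] ζ₀ := IsIntegral.of_pow hd (by rw [hζ₀.pow_eq_one]; exact isIntegral_one)
  have hcocσ₀ : kummerCocycleInt F hd hϖ.ne_zero σ₀ = ⟨ζ₀, hζ₀i⟩ := Subtype.ext (by
    rw [hcoc]; change σ₀ • z / z = ζ₀; rw [hσ₀, mul_div_assoc, div_self hz0, mul_one])
  -- Step 3b: `θ σ₀` has order `d`
  have hprim₀ : IsPrimitiveRoot (θ ⟨σ₀, hσ₀I⟩) d := by
    refine IsPrimitiveRoot.mk_of_lt _ hd (hθd _) fun l hl0 hld hl => ?_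
    apply hζ₀.pow_ne_one_of_pos_of_lt hl0.ne' hld
    have h1 : (θ ⟨σ₀, hσ₀I⟩ : k) ^ l = 1 := by
      rw [← Units.val_pow_eq_pow_val, hl, Units.val_one]
    rw [hθval, ← map_pow, ← map_pow, ← ι.map_one] at h1
    have h2' : Ideal.Quotient.mk (absMaximalIdeal F) (kummerCocycleInt F hd hϖ.ne_zero σ₀ ^ l) =
        Ideal.Quotient.mk (absMaximalIdeal F) 1 := by
      rw [map_one]; exact hι h1
    have h2 := Ideal.Quotient.eq.mp h2'
    have h3 : (kummerCocycleInt F hd hϖ.ne_zero σ₀) ^ l = 1 :=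
      eq_one_of_pow_eq_one_of_sub_one_mem_absMaximalIdeal hdu
        (by rw [← pow_mul, mul_comm, pow_mul, kummerCocycleInt_pow hd hϖ.ne_zero, one_pow]) h2
    have h4 := congrArg Subtype.val h3
    rw [SubmonoidClass.coe_pow, hcocσ₀, OneMemClass.coe_one] at h4
    exact h4
  -- Step 3c: `t = θ g` is a primitive `d`-th root of unity
  have ht : IsPrimitiveRoot t d := by
    obtain ⟨n, ν, hν, hσν⟩ := hg ⟨σ₀, hσ₀I⟩
    have hmem : θ ⟨σ₀, hσ₀I⟩ ∈ Subgroup.zpowers t := by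
      rw [hσν, hθeval ν hν n]
      exact Subgroup.zpow_mem _ (Subgroup.mem_zpowers t) n
    have hdvd : d ∣ orderOf t := by
      rw [hprim₀.eq_orderOf]
      exact orderOf_dvd_of_mem_zpowers hmem
    have hdvd' : orderOf t ∣ d := orderOf_dvd_of_pow_eq_one (hθd g)
    have horder : orderOf t = d := Nat.dvd_antisymm hdvd' hdvd
    rw [← horder]
    exact IsPrimitiveRoot.orderOf t
  -- Step 3d: `χ g = t ^ a`
  have ht' : IsPrimitiveRoot (t : k) d := IsPrimitiveRoot.coe_units_iff.mpr ht
  obtain ⟨a, -, ha⟩ := ht'.eq_pow_of_pow_eq_one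
    (show ((χ g : kˣ) : k) ^ d = 1 by rw [← Units.val_pow_eq_pow_val, hχd, Units.val_one])
  have ha' : χ g = t ^ a := Units.ext (by rw [Units.val_pow_eq_pow_val]; exact ha.symm)
  -- conclusion
  refine ⟨a, MonoidHom.ext fun σ => ?_⟩
  obtain ⟨n, ν, hν, rfl⟩ := hg σ
  rw [MonoidHom.pow_apply, hχeval ν hν n, hθeval ν hν n, ha', ← zpow_natCast, ← zpow_natCast,
    ← zpow_mul, ← zpow_mul, mul_comm]

/-- **Discharge of `Literature.NumberTheory.GaloisRepresentations.exists_eq_kummerCharacter_pow`**: every continuous character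
`χ : I_F → kˣ` (`k` discrete) with `χ ^ d = 1`, `p ∤ d`, is a power of the Kummer character
`θ_d = kummerCharacter F hd hϖ.ne_zero ι` of a uniformiser `ϖ`.  From
`exists_eq_kummerCharacter_pow_of_surjective` and the surjectivity of `θ_d`
(`IsNonarchimedeanLocalField.exists_mem_absInertia_smul_eq_mul`, applied to the chosen root
`kummerRoot F hd ϖ`, `coe_kummerRoot_pow`).
Serre, Invent. Math. 15 (1972), §1.3 ("l'application `θ_d : Gal(K_d/K_nr) → μ_d` … est un
isomorphisme"; Prop. 2: `θ : I_t ≃ lim← μ_d`) and §1.7, Prop. 5 ("l'application `a/d ↦ θ_d^a`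
est un isomorphisme de `(ℚ/ℤ)'` sur le groupe des caractères de `I_t` (à valeurs dans `k_s^*`)"),
and §1.7, "Plus généralement, soit `k₁` un corps de caractéristique `p` …" for characters with
values in an arbitrary field of characteristic `p` through an embedding (here `ι`).
[cite: SerreInventiones1972, §1.3 (θ_d isomorphisme; Prop. 1–2) and §1.7 Prop. 5] -/
theorem exists_eq_kummerCharacter_pow_holds : exists_eq_kummerCharacter_pow F k :=
  exists_eq_kummerCharacter_pow_of_surjective F k fun {_} hd {ϖ} hϖ {_} hζ =>
    exists_mem_absInertia_smul_eq_mul hd hϖ (coe_kummerRoot_pow F hd ϖ) hζ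

end Main

end Literature.NumberTheory.GaloisRepresentations
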